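import Summits.HubbardSuperconductivity.HubbardSuperconductivity.Theorems.AnisotropyChordSpinMonotoneTwoMagnonRookWeightedHopSums
import Summits.HubbardSuperconductivity.HubbardSuperconductivity.Theorems.AnisotropyChordXXZWeightedPair

/-!
# Route `AnisotropyChord`: THEOREM R wrapper — the three class equations of the two-magnon
# eigen-problem on the rook graph with direction weights

For the bond-weighted XXZ Hamiltonian `H = xxzHamiltonianWith 1 G J Δ` on the rook graph `G` on
`α × β` with direction couplings `J = ω₁` on row bonds and `J = ω₂` on column bonds (reals; the
ferromagnet is `ωᵢ = −Jᵢ < 0`), and an eigenvector `χ` (`Hχ = Eχ`) that is class-constant with real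
values `A, B, C` on row, column and far pairs, the pair equation `Weighted.xxzWith_mulVec_pair` and
the weighted class sums of `…RookWeightedHopSums` give the three class equations
(`wrook_eigen_relations`)
`E A = Δ(K + ω₁)A + (ω₁(|α|−2)A + ω₂(|β|−1)C)`, `E B = Δ(K + ω₂)B + (ω₂(|β|−2)B + ω₁(|α|−1)C)`,
`E C = Δ K C + (ω₂ A + ω₁ B + (ω₁(|α|−2) + ω₂(|β|−2))C)`, `K = ¼Σ_e J_e − ((|α|−1)ω₁ + (|β|−1)ω₂)`
(the pair Ising coefficient is `K + [i∼j]J_{ij}`: `pair_isingCoeff_rook`).  With `ωᵢ = −Jᵢ`,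
`p = |α|−1`, `q = |β|−1`, `Z₀ = −K`... these are exactly the hypotheses of `wrook_point_of_classes`
(file `…RookWeightedClasses`).  Counting only; no definition is introduced.
-/

set_option linter.dupNamespace false

noncomputable section

namespace Summit.HubbardSuperconductivity.HubbardSuperconductivity.Theorems.AnisotropyChord.TwoMagnon

open Matrix Complex Finset
open Literature.MathematicalPhysics.QuantumLattice
open Summit.HubbardSuperconductivity.HubbardSuperconductivity.Theorems.AnisotropyChord.Weighted
  (xxzWith_mulVec_pair sum_edgeFinset_weight_mul_lift_eq_half)

variable {α β : Type*} [Fintype α] [DecidableEq α] [Fintype β] [DecidableEq β]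
variable {G : SimpleGraph (α × β)} [DecidableRel G.Adj]

/-- **Weighted degree of the rook graph with direction weights**: `Σ_{y ∼ x} J_{xy} = (|α|−1)ω₁ +
(|β|−1)ω₂` at every vertex. [folklore] -/
theorem wrook_weightedDegree
    (hadj : ∀ x y : α × β, G.Adj x y ↔ (x.1 ≠ y.1 ∧ x.2 = y.2) ∨ (x.1 = y.1 ∧ x.2 ≠ y.2))
    {w : Sym2 (α × β) → ℂ} {ω₁ ω₂ : ℂ}
    (hw₁ : ∀ x y : α × β, x.1 ≠ y.1 → x.2 = y.2 → w s(x, y) = ω₁)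
    (hw₂ : ∀ x y : α × β, x.1 = y.1 → x.2 ≠ y.2 → w s(x, y) = ω₂) (x : α × β) :
    (∑ y, if G.Adj x y then w s(x, y) else 0) =
      ω₁ * ((Fintype.card α : ℂ) - 1) + ω₂ * ((Fintype.card β : ℂ) - 1) := by
  have h := wrook_sum_adj hadj hw₁ hw₂ x (fun _ => (1 : ℂ))
  simp only [mul_one] at h
  rw [h, sum_ite_eq_else x.1 1, sum_ite_eq_else x.2 1, mul_one, mul_one]

/-- **The "exactly one endpoint" weighted edge count at a pair** on the rook graph:
`Σ_e J_e [exactly one endpoint of e in {i,j}] = 2d − 2[i∼j]J_{ij}`, `d` the weighted degree.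
[folklore] -/
theorem wrook_sum_weight_oneEndpoint
    (hadj : ∀ x y : α × β, G.Adj x y ↔ (x.1 ≠ y.1 ∧ x.2 = y.2) ∨ (x.1 = y.1 ∧ x.2 ≠ y.2))
    {w : Sym2 (α × β) → ℂ} {ω₁ ω₂ : ℂ}
    (hw₁ : ∀ x y : α × β, x.1 ≠ y.1 → x.2 = y.2 → w s(x, y) = ω₁)
    (hw₂ : ∀ x y : α × β, x.1 = y.1 → x.2 ≠ y.2 → w s(x, y) = ω₂) {i j : α × β} (hij : i ≠ j) :
    (∑ x, ∑ y, (if G.Adj x y then w s(x, y) *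
        (if ((x = i ∨ x = j) ∧ ¬ (y = i ∨ y = j) ∨ ¬ (x = i ∨ x = j) ∧ (y = i ∨ y = j)) then (1 : ℂ)
          else 0) else 0)) =
      2 * (2 * (ω₁ * ((Fintype.card α : ℂ) - 1) + ω₂ * ((Fintype.card β : ℂ) - 1))
        - 2 * (if G.Adj i j then w s(i, j) else 0)) := by
  -- reduce to the weighted hop-sum identity with the constant pair function `1`
  have h := whopSum_eq_two_mul G w (fun _ => (1 : ℂ)) hij
  simp only [mul_one] at h
  have hl : (∑ x, ∑ y, (if G.Adj x y then w s(x, y) *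
      (if ((x = i ∨ x = j) ∧ ¬ (y = i ∨ y = j) ∨ ¬ (x = i ∨ x = j) ∧ (y = i ∨ y = j)) then (1 : ℂ)
        else 0) else 0)) =
      ∑ x, ∑ y, (if G.Adj x y then
        (if ((x = i ∨ x = j) ∧ ¬ (y = i ∨ y = j) ∨ ¬ (x = i ∨ x = j) ∧ (y = i ∨ y = j)) then
          w s(x, y) else 0) else 0) := by
    refine Finset.sum_congr rfl fun x _ => Finset.sum_congr rfl fun y _ => ?_
    split_ifs <;> simp
  rw [hl, h]
  -- the two neighbour sums with `{i, j}` excluded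
  have hi : (∑ y, if y = i ∨ y = j then 0 else if G.Adj i y then w s(i, y) else 0) =
      (ω₁ * ((Fintype.card α : ℂ) - 1) + ω₂ * ((Fintype.card β : ℂ) - 1))
        - (if G.Adj i j then w s(i, j) else 0) := by
    rw [← wrook_weightedDegree hadj hw₁ hw₂ i, Fintype.sum_eq_add_sum_compl i,
      Fintype.sum_eq_add_sum_compl i (fun y => if G.Adj i y then w s(i, y) else 0)]
    rw [if_pos (Or.inl rfl), if_neg (G.irrefl (v := i)), zero_add, zero_add]
    have hj : j ∈ ({i}ᶜ : Finset (α × β)) := by simp [Ne.symm hij]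
    rw [← Finset.add_sum_erase _ _ hj, ← Finset.add_sum_erase _ _ hj, if_pos (Or.inr rfl), zero_add]
    have hrest : ∀ y ∈ ({i}ᶜ : Finset (α × β)).erase j,
        (if y = i ∨ y = j then (0 : ℂ) else if G.Adj i y then w s(i, y) else 0) =
          (if G.Adj i y then w s(i, y) else 0) := by
      intro y hy
      rw [Finset.mem_erase, Finset.mem_compl, Finset.mem_singleton] at hy
      rw [if_neg (not_or.mpr ⟨hy.2, hy.1⟩)]
    rw [Finset.sum_congr rfl hrest]
    ring
  have hj : (∑ y, if y = i ∨ y = j then 0 else if G.Adj j y then w s(j, y) else 0) =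
      (ω₁ * ((Fintype.card α : ℂ) - 1) + ω₂ * ((Fintype.card β : ℂ) - 1))
        - (if G.Adj i j then w s(i, j) else 0) := by
    rw [← wrook_weightedDegree hadj hw₁ hw₂ j, Fintype.sum_eq_add_sum_compl j,
      Fintype.sum_eq_add_sum_compl j (fun y => if G.Adj j y then w s(j, y) else 0)]
    rw [if_pos (Or.inr rfl), if_neg (G.irrefl (v := j)), zero_add, zero_add]
    have hi' : i ∈ ({j}ᶜ : Finset (α × β)) := by simp [hij]
    rw [← Finset.add_sum_erase _ _ hi', ← Finset.add_sum_erase _ _ hi', if_pos (Or.inl rfl), zero_add]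
    have e1 : (if G.Adj j i then w s(j, i) else (0 : ℂ)) = (if G.Adj i j then w s(i, j) else 0) := by
      by_cases h : G.Adj i j
      · rw [if_pos h, if_pos h.symm, Sym2.eq_swap]
      · rw [if_neg h, if_neg (fun h' => h h'.symm)]
    rw [e1]
    have hrest : ∀ y ∈ ({j}ᶜ : Finset (α × β)).erase i,
        (if y = i ∨ y = j then (0 : ℂ) else if G.Adj j y then w s(j, y) else 0) =
          (if G.Adj j y then w s(j, y) else 0) := by
      intro y hy
      rw [Finset.mem_erase, Finset.mem_compl, Finset.mem_singleton] at hy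
      rw [if_neg (not_or.mpr ⟨hy.1, hy.2⟩)]
    rw [Finset.sum_congr rfl hrest]
    ring
  rw [hi, hj]
  ring

/-- **Pair Ising coefficient on the rook graph** (complex form): `Σ_e J_e ζ_e(i,j) = ¼Σ_e J_e − d
+ [i∼j]J_{ij}`, `d = (|α|−1)ω₁ + (|β|−1)ω₂` (ζ = −¼ on bonds with exactly one endpoint in `{i,j}`,
`+¼` otherwise). [folklore] -/
theorem pair_isingCoeff_rook
    (hadj : ∀ x y : α × β, G.Adj x y ↔ (x.1 ≠ y.1 ∧ x.2 = y.2) ∨ (x.1 = y.1 ∧ x.2 ≠ y.2))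
    (J : Sym2 (α × β) → ℝ) {ω₁ ω₂ : ℝ}
    (hw₁ : ∀ x y : α × β, x.1 ≠ y.1 → x.2 = y.2 → J s(x, y) = ω₁)
    (hw₂ : ∀ x y : α × β, x.1 = y.1 → x.2 ≠ y.2 → J s(x, y) = ω₂) {i j : α × β} (hij : i ≠ j) :
    (∑ e ∈ G.edgeFinset, (J e : ℂ) * ((Sym2.lift ⟨fun x y =>
        if ((x = i ∨ x = j) ∧ ¬ (y = i ∨ y = j) ∨ ¬ (x = i ∨ x = j) ∧ (y = i ∨ y = j))
        then -((1 : ℝ) / 4) else 1 / 4, fun x y => by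
          by_cases hx : x = i ∨ x = j <;> by_cases hy : y = i ∨ y = j <;> simp [hx, hy]⟩ e : ℝ) : ℂ)) =
      (1 / 4 : ℂ) * (∑ e ∈ G.edgeFinset, (J e : ℂ))
        - (((Fintype.card α : ℂ) - 1) * (ω₁ : ℂ) + ((Fintype.card β : ℂ) - 1) * (ω₂ : ℂ))
        + (if G.Adj i j then ((J s(i, j) : ℝ) : ℂ) else 0) := by
  -- ζ = ¼ − ½·[one]
  have hζ : ∀ e ∈ G.edgeFinset, (J e : ℂ) * ((Sym2.lift ⟨fun x y =>
        if ((x = i ∨ x = j) ∧ ¬ (y = i ∨ y = j) ∨ ¬ (x = i ∨ x = j) ∧ (y = i ∨ y = j))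
        then -((1 : ℝ) / 4) else 1 / 4, fun x y => by
          by_cases hx : x = i ∨ x = j <;> by_cases hy : y = i ∨ y = j <;> simp [hx, hy]⟩ e : ℝ) : ℂ) =
      (1 / 4 : ℂ) * (J e : ℂ) - (1 / 2 : ℂ) * ((fun e => (J e : ℂ)) e * Sym2.lift ⟨fun x y =>
        if ((x = i ∨ x = j) ∧ ¬ (y = i ∨ y = j) ∨ ¬ (x = i ∨ x = j) ∧ (y = i ∨ y = j))
        then (1 : ℂ) else 0, fun x y => by
          by_cases hx : x = i ∨ x = j <;> by_cases hy : y = i ∨ y = j <;> simp [hx, hy]⟩ e) := by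
    intro e _
    induction e using Sym2.ind with
    | h x y =>
      simp only [Sym2.lift_mk]
      split_ifs <;> push_cast <;> ring
  rw [Finset.sum_congr rfl hζ, Finset.sum_sub_distrib, ← Finset.mul_sum, ← Finset.mul_sum,
    sum_edgeFinset_weight_mul_lift_eq_half G (fun e => (J e : ℂ)),
    wrook_sum_weight_oneEndpoint hadj (w := fun e => (J e : ℂ)) (ω₁ := (ω₁ : ℂ)) (ω₂ := (ω₂ : ℂ))
      (fun x y hx hy => by simp only [hw₁ x y hx hy]) (fun x y hx hy => by simp only [hw₂ x y hx hy]) hij]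
  ring

/-- **The three class equations of the weighted rook two-magnon eigen-problem.**  For an eigenvector
`χ` of `xxzHamiltonianWith 1 G J Δ` (`Hχ = Eχ`) on the rook graph with direction couplings
`ω₁` (row bonds), `ω₂` (column bonds), class-constant with real values `A, B, C` on row, column and far
pairs (`|α|, |β| ≥ 2` witnessed by `a₀ ≠ a₁`, `b₀ ≠ b₁`), and
`K = ¼Σ_e J_e − ((|α|−1)ω₁ + (|β|−1)ω₂)`:
`E A = Δ(K+ω₁)A + (ω₁(|α|−2)A + ω₂(|β|−1)C)`, `E B = Δ(K+ω₂)B + (ω₂(|β|−2)B + ω₁(|α|−1)C)`,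
`E C = Δ K C + (ω₂A + ω₁B + (ω₁(|α|−2) + ω₂(|β|−2))C)`.  Weighted twin of `rook_eigen_relations`.
[folklore] -/
theorem wrook_eigen_relations
    (hadj : ∀ x y : α × β, G.Adj x y ↔ (x.1 ≠ y.1 ∧ x.2 = y.2) ∨ (x.1 = y.1 ∧ x.2 ≠ y.2))
    (J : Sym2 (α × β) → ℝ) {ω₁ ω₂ : ℝ}
    (hw₁ : ∀ x y : α × β, x.1 ≠ y.1 → x.2 = y.2 → J s(x, y) = ω₁)
    (hw₂ : ∀ x y : α × β, x.1 = y.1 → x.2 ≠ y.2 → J s(x, y) = ω₂)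
    {a₀ a₁ : α} (hα : a₀ ≠ a₁) {b₀ b₁ : β} (hβ : b₀ ≠ b₁)
    {χ : (α × β → Fin 2) → ℂ} {A B C : ℝ}
    (hA : ∀ x y : α × β, x.1 ≠ y.1 → x.2 = y.2 → χ (Pi.single x 1 + Pi.single y 1) = A)
    (hB : ∀ x y : α × β, x.1 = y.1 → x.2 ≠ y.2 → χ (Pi.single x 1 + Pi.single y 1) = B)
    (hC : ∀ x y : α × β, x.1 ≠ y.1 → x.2 ≠ y.2 → χ (Pi.single x 1 + Pi.single y 1) = C)
    {Δ E : ℝ} (hH : xxzHamiltonianWith 1 G J Δ *ᵥ χ = ((E : ℝ) : ℂ) • χ)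
    (K : ℝ) (hK : K = (1 : ℝ) / 4 * (∑ e ∈ G.edgeFinset, J e)
      - (((Fintype.card α : ℝ) - 1) * ω₁ + ((Fintype.card β : ℝ) - 1) * ω₂)) :
    E * A = Δ * (K + ω₁) * A + (ω₁ * ((Fintype.card α : ℝ) - 2) * A
      + ω₂ * ((Fintype.card β : ℝ) - 1) * C) ∧
    E * B = Δ * (K + ω₂) * B + (ω₂ * ((Fintype.card β : ℝ) - 2) * B
      + ω₁ * ((Fintype.card α : ℝ) - 1) * C) ∧
    E * C = Δ * K * C + (ω₂ * A + ω₁ * B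
      + (ω₁ * ((Fintype.card α : ℝ) - 2) + ω₂ * ((Fintype.card β : ℝ) - 2)) * C) := by
  have hw₁' : ∀ x y : α × β, x.1 ≠ y.1 → x.2 = y.2 → ((J s(x, y) : ℝ) : ℂ) = (ω₁ : ℂ) :=
    fun x y hx hy => by rw [hw₁ x y hx hy]
  have hw₂' : ∀ x y : α × β, x.1 = y.1 → x.2 ≠ y.2 → ((J s(x, y) : ℝ) : ℂ) = (ω₂ : ℂ) :=
    fun x y hx hy => by rw [hw₂ x y hx hy]
  have hA' : ∀ x y : α × β, x.1 ≠ y.1 → x.2 = y.2 → χ (Pi.single x 1 + Pi.single y 1) = (A : ℂ) := hA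
  have hB' : ∀ x y : α × β, x.1 = y.1 → x.2 ≠ y.2 → χ (Pi.single x 1 + Pi.single y 1) = (B : ℂ) := hB
  have hC' : ∀ x y : α × β, x.1 ≠ y.1 → x.2 ≠ y.2 → χ (Pi.single x 1 + Pi.single y 1) = (C : ℂ) := hC
  have hKc : (1 / 4 : ℂ) * (∑ e ∈ G.edgeFinset, (J e : ℂ))
      - (((Fintype.card α : ℂ) - 1) * (ω₁ : ℂ) + ((Fintype.card β : ℂ) - 1) * (ω₂ : ℂ)) = (K : ℂ) := by
    rw [hK]; push_cast; ring
  -- the three reference pairs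
  have hrow : ((a₀, b₀) : α × β) ≠ (a₁, b₀) := fun h => hα (congrArg Prod.fst h)
  have hcol : ((a₀, b₀) : α × β) ≠ (a₀, b₁) := fun h => hβ (congrArg Prod.snd h)
  have hfar : ((a₀, b₀) : α × β) ≠ (a₁, b₁) := fun h => hα (congrArg Prod.fst h)
  have adjrow : G.Adj (a₀, b₀) (a₁, b₀) := (hadj _ _).2 (Or.inl ⟨hα, rfl⟩)
  have adjcol : G.Adj (a₀, b₀) (a₀, b₁) := (hadj _ _).2 (Or.inr ⟨rfl, hβ⟩)
  have adjfar : ¬ G.Adj (a₀, b₀) (a₁, b₁) := by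
    rw [hadj]; push Not; exact ⟨fun _ h => absurd h.symm hβ.symm, fun h => absurd h hα⟩
  -- evaluate the eigen-equation at a pair: diagonal coefficient and hop sums
  have heval : ∀ {i j : α × β}, i ≠ j →
      (E : ℂ) * χ (Pi.single i 1 + Pi.single j 1) =
        (Δ : ℂ) * ((K : ℂ) + (if G.Adj i j then ((J s(i, j) : ℝ) : ℂ) else 0))
            * χ (Pi.single i 1 + Pi.single j 1)
          + (1 / 4 : ℂ) * (2 * ((∑ y, if y = i ∨ y = j then 0 else
                if G.Adj i y then ((J s(i, y) : ℝ) : ℂ) * χ (Pi.single y 1 + Pi.single j 1)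
                else 0)
              + (∑ y, if y = i ∨ y = j then 0 else
                if G.Adj j y then ((J s(j, y) : ℝ) : ℂ) * χ (Pi.single i 1 + Pi.single y 1)
                else 0))) := by
    intro i j hij
    have hdiag : ((Δ * ∑ e ∈ G.edgeFinset, J e * Sym2.lift ⟨fun x y =>
          if ((x = i ∨ x = j) ∧ ¬ (y = i ∨ y = j) ∨ ¬ (x = i ∨ x = j) ∧ (y = i ∨ y = j))
          then -((1 : ℝ) / 4) else 1 / 4, fun x y => by
            by_cases hx : x = i ∨ x = j <;> by_cases hy : y = i ∨ y = j <;> simp [hx, hy]⟩ e : ℝ) : ℂ)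
        = (Δ : ℂ) * ((K : ℂ) + (if G.Adj i j then ((J s(i, j) : ℝ) : ℂ) else 0)) := by
      push_cast
      rw [pair_isingCoeff_rook (G := G) hadj J hw₁ hw₂ hij, hKc]
    have h := congrFun hH (Pi.single i 1 + Pi.single j 1)
    rw [Pi.smul_apply, smul_eq_mul, xxzWith_mulVec_pair G J Δ χ hij,
      whopSum_eq_two_mul G (fun e => (J e : ℂ)) χ hij, hdiag] at h
    exact h.symm
  refine ⟨?_, ?_, ?_⟩
  · have h := heval hrow
    rw [rowPair_whopSum (w := fun e => (J e : ℂ)) hadj hw₁' hw₂' hA' hC' (i := (a₀, b₀))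
        (j := (a₁, b₀)) hα rfl,
      rowPair_whopSum' (w := fun e => (J e : ℂ)) hadj hw₁' hw₂' hA' hC' (i := (a₀, b₀))
        (j := (a₁, b₀)) hα rfl, if_pos adjrow, hA (a₀, b₀) (a₁, b₀) hα rfl,
      hw₁ (a₀, b₀) (a₁, b₀) hα rfl] at h
    apply Complex.ofReal_injective
    push_cast at h ⊢
    linear_combination h
  · have h := heval hcol
    rw [colPair_whopSum (w := fun e => (J e : ℂ)) hadj hw₁' hw₂' hB' hC' (i := (a₀, b₀))
        (j := (a₀, b₁)) rfl hβ,
      colPair_whopSum' (w := fun e => (J e : ℂ)) hadj hw₁' hw₂' hB' hC' (i := (a₀, b₀))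
        (j := (a₀, b₁)) rfl hβ, if_pos adjcol, hB (a₀, b₀) (a₀, b₁) rfl hβ,
      hw₂ (a₀, b₀) (a₀, b₁) rfl hβ] at h
    apply Complex.ofReal_injective
    push_cast at h ⊢
    linear_combination h
  · have h := heval hfar
    rw [farPair_whopSum (w := fun e => (J e : ℂ)) hadj hw₁' hw₂' hA' hB' hC' (i := (a₀, b₀))
        (j := (a₁, b₁)) hα hβ,
      farPair_whopSum' (w := fun e => (J e : ℂ)) hadj hw₁' hw₂' hA' hB' hC' (i := (a₀, b₀))
        (j := (a₁, b₁)) hα hβ, if_neg adjfar, add_zero, hC (a₀, b₀) (a₁, b₁) hα hβ] at h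
    apply Complex.ofReal_injective
    push_cast at h ⊢
    linear_combination h

end Summit.HubbardSuperconductivity.HubbardSuperconductivity.Theorems.AnisotropyChord.TwoMagnon
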